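import Summits.QuantumFields.BalabanUV.Beta.FP.TowerDoorGaugeTheta

/-!
# `BalabanUV.Beta.FP.TowerDoorGaugeFunctional` — binder row D1, the row's ONE file, LEMMA U ⇒ `hΘ` FOR EVERY COVARIANT `ℓ¹` DOOR FUNCTIONAL (J-NOTE-21 §2–§4):
# **if the door's functional at the window `(κ, y)` is an `ℓ¹` pairing against a weight translated to the block `L•y` — `τ_κ,y(v) = Σ'_u ω_κ(u − L•y)·v(u)` — then on the lattice gauge functions
# `lam μ z := λℤ_(μ,z)` the END's two letters hold: `hτ` (`τ_κ,y(λℤ_(μ,z)) = τ_κ,y−z(λℤ_(μ,0))`, PART 58's joint covariance) and `hΘ` (`Σ'_y τ_κ,y(λℤ_(μ,0)) = 0`, PART 60's Fubini + PART 58)**;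
# §3 packages the same in the END's TYPES (p670056 §5: `τ j κ y : V j →ₗ[ℝ] ℝ`, `lam j μ z : V j`) with `V j := ↥(lp (fun _ : Site 4 => ℝ) ⊤)` — the bounded gauge functions (Q-an2-77-1 (a)):
# `l1Pairing ω hω : lp _ ⊤ →ₗ[ℝ] ℝ` ([our object — bookkeeping], generic) and `λℤ ∈ ℓ^∞` (PART 59)
# (β-function cell `pub-balaban`, BINDER-OWNERS row D1 ∕ (C1) OWNER «beta-an2» gen 77, PART 61; imports PART 60)

WHAT ([folklore] `tsum` re-indexing BY NAME + one generic bookkeeping `def`; no `def … : Prop`, nothing cited, 0 sorry, default heartbeats).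
§1 (generic `d`, kernel-generic, any `lev rs hrs`): `lamZ_eq_lamZ_zero_sub` (`λℤ_(μ,z)(u) = λℤ_(μ,0)(u − L•z)`), **`tsum_mul_translate_lamZ`** (`hτ`'s shape:
`Σ'_u ω(u − L•y)·λℤ_(μ,z)(u) = Σ'_u ω(u − L•(y − z))·λℤ_(μ,0)(u)` — `Equiv.subRight`, no convergence needed), **`tsum_tsum_translate_mul_lamZ_eq_zero`** (`hΘ`'s shape: for `Decays A C δ`, `0 < δ`,
`Σ|ω| < ∞` and vanishing sitewise source sums, `Σ'_y Σ'_u ω(u − L•y)·λℤ_(μ,0)(u) = 0` — re-index `u ↦ u + L•y`, covariance `λℤ_(μ,0)(u + L•y) = λℤ_(μ,−y)(u)`, `y ↦ −y`, PART 60).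
§2 (`d = 3`) the record's chart: `tsum_tsum_translate_mul_lamZ_record_eq_zero`, hypothesis-free but for `Σ|ω| < ∞`.
§3 the `ℓ^∞` packaging: `l1Pairing` (def) + `l1Pairing_apply`, `memℓp_top_lamZ` ∕ `memℓp_top_lamZ_record` (PART 59 `exists_abs_lamZ_le`), **`tsum_l1Pairing_lamZ_record_eq_zero`** — the END's `hΘ` letter AS TYPED
for `τ j κ y := κτ • l1Pairing (ω_κ(· − L•y))`, `lam j μ z := ⟨λℤ_(μ,z), memℓp⟩`, any `ω_κ ∈ ℓ¹`, any `κτ`.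
WHAT THIS IS NOT: the door's ACTUAL weight `ω_κ` (the tadpole weights of `DefKerℤ`, J-NOTE-21 §4 (ii)) is NOT defined here — this file discharges `hτ`∕`hΘ` for the whole CLASS of covariant `ℓ¹` functionals;
the door NOT defined; (X), (T2) NOT claimed; nothing of Bałaban's asserted, valued or discharged; 0 estimates; 0∕4 row-D1 binders (hW, hR, D1Tel, D1Rep); v10 NOT filed; v9 p617999 stands; NOT (C1),
NOT (T-ID), NOT D1, NEVER «G-an2-4 closed», NOT BetaPertH, NOT continuum, NOT Clay.

HONEST DEPENDENCY (page 1, mandatory): continuum YM on T⁴ ⇐ BetaPertH ∧ nine spine estimates (0/9 proved); BetaPertH ⇐ (D1) ∧ (D4) ∧ CAP+tail;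
G-an2-4 gates asym, D1 and NE2/3/4.  HONEST FRAMING (cell contract, verbatim): «discharging `BetaPertH` makes Bałaban's UV stability UNCONDITIONAL —
a real constructive-QFT result; it is NOT the continuum limit and NOT the Clay problem.»  ABSOLUTE RULE (cell charter, verbatim): «No internally-minted
statement may enter as a cited fact. Every hypothesis is either kernel-proved in this package or a verbatim quotation of a PUBLISHED theorem with page
reference. The manuscript(s) under audit are NOT citable for their own disputed steps — they are the thing under adjudication; programme-internal
(2001/route/tribunal) claims are never citable.»  Row D1 ∕ (C1) OWNER «beta-an2» gen 77, 2026-08-29.  No existing file touched.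
-/

noncomputable section

open Finset
open scoped BigOperators ENNReal
open Literature.MathematicalPhysics.QuantumFieldTheory
open Literature.MathematicalPhysics.QuantumFieldTheory.Balaban1983to89
open Literature.MathematicalPhysics.QuantumFieldTheory.Balaban1983to89.Beta
open B6Lemma24Torus (pbox)
open AffineAveraging (Site toSite unitVec)
open OneStepResolventKernel (Fib)
open ExpKernelCalculus (MKer Decays)
open HessKerRate (scaleK)
open Summit.QuantumFields.BalabanUV.Beta.CompositeOneShotJetData (Roots AN)
open Summit.QuantumFields.BalabanUV.Beta.FP.TorusCompositeObjects (bigRatio bigRatio_pos)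
open Summit.QuantumFields.BalabanUV.Beta.FP.TowerDoorGaugeRefDefs (lamZ)
open Summit.QuantumFields.BalabanUV.Beta.FP.TowerDoorGaugeLatticeSum (lamZ_translate tsum_lamZ_sources_record)
open Summit.QuantumFields.BalabanUV.Beta.FP.TowerDoorGaugeBound (exists_abs_lamZ_le decays_scaleK_AN)
open Summit.QuantumFields.BalabanUV.Beta.FP.TowerDoorGaugeTheta (tsum_tsum_mul_lamZ_eq_zero)

namespace Summit.QuantumFields.BalabanUV.Beta.FP.TowerDoorGaugeFunctional

variable {d : ℕ}

/-! ## §1 Kernel-generic: `hτ`'s and `hΘ`'s shapes for a covariant `ℓ¹` functional -/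

section Generic

variable (Lc : ℕ) [NeZero Lc] (lev : ℕ → ℕ) (rs : ℕ → (Fin (d + 1) → ℕ))
  (hrs : ∀ k i, 0 ≤ toSite (rs k) i ∧ toSite (rs k) i < (Lc : ℤ)) (n : ℕ) (A : MKer (d + 1) (Fib d))

/-- [folklore] `λℤ_(μ,z)(u) = λℤ_(μ,0)(u − L•z)` (PART 58 `lamZ_translate`). -/
theorem lamZ_eq_lamZ_zero_sub (μ : Fin (d + 1)) (z u : Site (d + 1)) :
    lamZ Lc lev rs hrs n A μ z u = lamZ Lc lev rs hrs n A μ 0 (u - ((bigRatio Lc (n + 1) : ℕ) : ℤ) • z) := by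
  have h := lamZ_translate Lc lev rs hrs n A μ 0 (u - ((bigRatio Lc (n + 1) : ℕ) : ℤ) • z) z
  rw [zero_add, sub_add_cancel] at h
  exact h

/-- [folklore] **`tsum_mul_translate_lamZ` — `hτ`'s SHAPE**: `Σ'_u ω(u − L•y)·λℤ_(μ,z)(u) = Σ'_u ω(u − L•(y − z))·λℤ_(μ,0)(u)` (re-index `u ↦ u + L•z`; no convergence needed). -/
theorem tsum_mul_translate_lamZ (ω : Site (d + 1) → ℝ) (μ : Fin (d + 1)) (y z : Site (d + 1)) :
    (∑' u : Site (d + 1), ω (u - ((bigRatio Lc (n + 1) : ℕ) : ℤ) • y) * lamZ Lc lev rs hrs n A μ z u)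
      = ∑' u : Site (d + 1), ω (u - ((bigRatio Lc (n + 1) : ℕ) : ℤ) • (y - z)) * lamZ Lc lev rs hrs n A μ 0 u := by
  rw [← (Equiv.addRight (((bigRatio Lc (n + 1) : ℕ) : ℤ) • z)).tsum_eq
    (fun u : Site (d + 1) => ω (u - ((bigRatio Lc (n + 1) : ℕ) : ℤ) • y) * lamZ Lc lev rs hrs n A μ z u)]
  refine tsum_congr fun u => ?_
  simp only [Equiv.coe_addRight]
  rw [lamZ_eq_lamZ_zero_sub Lc lev rs hrs n A μ z, add_sub_cancel_right, smul_sub]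
  congr 2
  abel

/-- [folklore] **`tsum_tsum_translate_mul_lamZ_eq_zero` — `hΘ`'s SHAPE**: for a `δ`-decaying chart (`0 < δ`), `Σ|ω| < ∞` and vanishing sitewise source sums (PART 58),
`Σ'_y Σ'_u ω(u − L•y)·λℤ_(μ,0)(u) = 0` (re-index `u ↦ u + L•y`, covariance `λℤ_(μ,0)(u + L•y) = λℤ_(μ,−y)(u)`, `y ↦ −y`, PART 60 `tsum_tsum_mul_lamZ_eq_zero`). -/
theorem tsum_tsum_translate_mul_lamZ_eq_zero {C δ : ℝ} (hA : Decays A C δ) (hδ : 0 < δ)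
    (ω : Site (d + 1) → ℝ) (hω : Summable (fun u => |ω u|)) (μ : Fin (d + 1))
    (hzero : ∀ u : Site (d + 1), (∑' z : Site (d + 1), lamZ Lc lev rs hrs n A μ z u) = 0) :
    (∑' y : Site (d + 1), ∑' u : Site (d + 1), ω (u - ((bigRatio Lc (n + 1) : ℕ) : ℤ) • y) * lamZ Lc lev rs hrs n A μ 0 u) = 0 := by
  have e : ∀ y : Site (d + 1), (∑' u : Site (d + 1), ω (u - ((bigRatio Lc (n + 1) : ℕ) : ℤ) • y) * lamZ Lc lev rs hrs n A μ 0 u)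
      = ∑' u : Site (d + 1), ω u * lamZ Lc lev rs hrs n A μ (-y) u := by
    intro y
    rw [← (Equiv.addRight (((bigRatio Lc (n + 1) : ℕ) : ℤ) • y)).tsum_eq
      (fun u : Site (d + 1) => ω (u - ((bigRatio Lc (n + 1) : ℕ) : ℤ) • y) * lamZ Lc lev rs hrs n A μ 0 u)]
    refine tsum_congr fun u => ?_
    simp only [Equiv.coe_addRight, add_sub_cancel_right]
    have h := lamZ_translate Lc lev rs hrs n A μ (-y) u y
    rw [neg_add_cancel] at h
    rw [h]
  simp_rw [e]
  rw [← (Equiv.neg (Site (d + 1))).tsum_eq (fun y : Site (d + 1) => ∑' u : Site (d + 1), ω u * lamZ Lc lev rs hrs n A μ (-y) u)]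
  simp only [Equiv.neg_apply, neg_neg]
  exact tsum_tsum_mul_lamZ_eq_zero Lc lev rs hrs n hA hδ ω hω μ hzero

end Generic

/-! ## §2 The record's chart -/

section Record

variable {Lc : ℕ} [NeZero Lc] (R : Roots Lc) (lev : ℕ → ℕ) (rs : ℕ → (Fin (3 + 1) → ℕ))
  (hrs : ∀ k i, 0 ≤ toSite (rs k) i ∧ toSite (rs k) i < (Lc : ℤ)) (n : ℕ) (σ : Fib 3 → ℝ)

/-- [folklore] **`tsum_tsum_translate_mul_lamZ_record_eq_zero`** — `hΘ`'s shape for the record's chart, hypothesis-free but for `Σ|ω| < ∞`: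
`Σ'_y Σ'_u ω(u − L•y)·lamZ Lc lev rs hrs n (scaleK σ σ (AN R (n+1))) μ 0 u = 0`. -/
theorem tsum_tsum_translate_mul_lamZ_record_eq_zero (ω : Site (3 + 1) → ℝ) (hω : Summable (fun u => |ω u|)) (μ : Fin (3 + 1)) :
    (∑' y : Site (3 + 1), ∑' u : Site (3 + 1),
        ω (u - ((bigRatio Lc (n + 1) : ℕ) : ℤ) • y) * lamZ Lc lev rs hrs n (scaleK σ σ (AN R (n + 1))) μ 0 u) = 0 := by
  obtain ⟨δ, C, hδ, _, hA⟩ := decays_scaleK_AN R σ (n + 1)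
  exact tsum_tsum_translate_mul_lamZ_eq_zero Lc lev rs hrs n (scaleK σ σ (AN R (n + 1))) hA hδ ω hω μ
    (fun u => tsum_lamZ_sources_record R lev rs hrs n σ μ u)

end Record

/-! ## §3 The `ℓ^∞` packaging in the END's types (`V j := ↥(lp (fun _ : Site 4 => ℝ) ⊤)`) -/

section Linfty

variable {ι : Type*}

/-- [folklore] an `ℓ¹` weight against a bounded family is absolutely summable. -/
theorem summable_mul_of_memℓp_top (ω : ι → ℝ) (hω : Summable (fun i => |ω i|)) (v : ↥(lp (fun _ : ι => ℝ) ⊤)) :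
    Summable (fun i => ω i * (v : ι → ℝ) i) := by
  refine Summable.of_norm_bounded (g := fun i => |ω i| * ‖v‖) (hω.mul_right ‖v‖) fun i => ?_
  rw [norm_mul, Real.norm_eq_abs]
  exact mul_le_mul_of_nonneg_left (lp.norm_apply_le_norm ENNReal.top_ne_zero v i) (abs_nonneg _)

/-- [our object — bookkeeping] **THE `ℓ¹`–`ℓ^∞` PAIRING AS A LINEAR FUNCTIONAL ON THE BOUNDED FAMILIES**: `l1Pairing ω hω v := Σ'_i ω i · v i` for `Σ|ω| < ∞`, `v ∈ ℓ^∞` — the type of the END's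
door functional `τ j κ y : V j →ₗ[ℝ] ℝ` on `V j := ↥(lp (fun _ : Site 4 => ℝ) ⊤)`. -/
def l1Pairing (ω : ι → ℝ) (hω : Summable (fun i => |ω i|)) : ↥(lp (fun _ : ι => ℝ) ⊤) →ₗ[ℝ] ℝ where
  toFun v := ∑' i, ω i * (v : ι → ℝ) i
  map_add' v w := by
    rw [← (summable_mul_of_memℓp_top ω hω v).tsum_add (summable_mul_of_memℓp_top ω hω w)]
    refine tsum_congr fun i => ?_
    rw [lp.coeFn_add, Pi.add_apply, mul_add]
  map_smul' c v := by
    rw [RingHom.id_apply, smul_eq_mul, ← tsum_mul_left]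
    refine tsum_congr fun i => ?_
    rw [lp.coeFn_smul, Pi.smul_apply, smul_eq_mul]
    ring

/-- [folklore] `l1Pairing` unfolded. -/
theorem l1Pairing_apply (ω : ι → ℝ) (hω : Summable (fun i => |ω i|)) (v : ↥(lp (fun _ : ι => ℝ) ⊤)) :
    l1Pairing ω hω v = ∑' i, ω i * (v : ι → ℝ) i := rfl

variable (Lc : ℕ) [NeZero Lc] (lev : ℕ → ℕ) (rs : ℕ → (Fin (d + 1) → ℕ))
  (hrs : ∀ k i, 0 ≤ toSite (rs k) i ∧ toSite (rs k) i < (Lc : ℤ)) (n : ℕ)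

/-- [folklore] **`λℤ_(μ,z)` IS A BOUNDED GAUGE FUNCTION** (`Memℓp … ⊤`, PART 59 `exists_abs_lamZ_le`). -/
theorem memℓp_top_lamZ {A : MKer (d + 1) (Fib d)} {C δ : ℝ} (hA : Decays A C δ) (hδ : 0 ≤ δ) (μ : Fin (d + 1)) (z : Site (d + 1)) :
    Memℓp (fun u : Site (d + 1) => lamZ Lc lev rs hrs n A μ z u) ⊤ := by
  obtain ⟨K, _, h⟩ := exists_abs_lamZ_le Lc lev rs hrs n hA hδ
  exact memℓp_infty ⟨K, by rintro _ ⟨u, rfl⟩; simpa [Real.norm_eq_abs] using h μ z u⟩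

variable {Lc' : ℕ} [NeZero Lc'] (R : Roots Lc') (rs' : ℕ → (Fin (3 + 1) → ℕ))
  (hrs' : ∀ k i, 0 ≤ toSite (rs' k) i ∧ toSite (rs' k) i < (Lc' : ℤ)) (σ : Fib 3 → ℝ)

/-- [folklore] the record's `λℤ_(μ,z)` is a bounded gauge function. -/
theorem memℓp_top_lamZ_record (μ : Fin (3 + 1)) (z : Site (3 + 1)) :
    Memℓp (fun u : Site (3 + 1) => lamZ Lc' lev rs' hrs' n (scaleK σ σ (AN R (n + 1))) μ z u) ⊤ := by
  obtain ⟨δ, C, hδ, _, hA⟩ := decays_scaleK_AN R σ (n + 1)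
  exact memℓp_top_lamZ Lc' lev rs' hrs' n hA hδ.le μ z

/-- [folklore] **`tsum_l1Pairing_lamZ_record_eq_zero` — THE END's `hΘ` AS TYPED, for every covariant `ℓ¹` door functional**: with `V := ↥(lp (fun _ : Site 4 => ℝ) ⊤)`,
`τ κ y := κτ • l1Pairing (ω_κ(· − L•y))`, `lam μ z := ⟨λℤ_(μ,z), memℓp⟩` (the record's chart): `Σ'_y τ κ y (lam μ 0) = 0`. -/
theorem tsum_l1Pairing_lamZ_record_eq_zero (ω : Site (3 + 1) → ℝ) (hω : Summable (fun u => |ω u|)) (κτ : ℝ) (μ : Fin (3 + 1)) :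
    (∑' y : Site (3 + 1), (κτ • l1Pairing (fun u : Site (3 + 1) => ω (u - ((bigRatio Lc' (n + 1) : ℕ) : ℤ) • y))
        ((Equiv.subRight (((bigRatio Lc' (n + 1) : ℕ) : ℤ) • y)).summable_iff.mpr hω))
      (⟨fun u : Site (3 + 1) => lamZ Lc' lev rs' hrs' n (scaleK σ σ (AN R (n + 1))) μ 0 u, memℓp_top_lamZ_record lev n R rs' hrs' σ μ 0⟩ : ↥(lp (fun _ : Site (3 + 1) => ℝ) ⊤))) = 0 := by
  simp only [LinearMap.smul_apply, l1Pairing_apply, smul_eq_mul]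
  rw [tsum_mul_left, tsum_tsum_translate_mul_lamZ_record_eq_zero R lev rs' hrs' n σ ω hω μ, mul_zero]

end Linfty

end Summit.QuantumFields.BalabanUV.Beta.FP.TowerDoorGaugeFunctional

end
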